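import Literature.AnabelianGeometry.SemiGraphs.PSCEdgeLikeCharacterizationReduction
import Literature.AnabelianGeometry.SemiGraphs.PSCTwoTripodOrigin
import Literature.AnabelianGeometry.SemiGraphs.PSCCuspidalCriterionOriginReduction
import Literature.AnabelianGeometry.SemiGraphs.ProSigmaCompletionTFG
import HarnessLib

/-!
# [IUTchI] Rmk. 1.2.3 (iv)/(v) at the genuine TWO-TRIPOD datum (two vertices, one node, four cusps) — by the Prop. 1.2 (i) route

Mochizuki, *Inter-universal Teichmüller theory I* [IUTchI] Rmk. 1.2.3 (iv), (v) (kurims pp. 41–43): the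
cuspidal / nodal edge-like subgroups of `Π_G` "may be characterized as the maximal closed subgroups
`A ⊆ Π_G` isomorphic to `ℤ_l` which satisfy the following condition: for every characteristic open subgroup
`Π_{G'} ⊆ Π_G` … the cyclic finite étale covering `G' → G''` is cuspidally (resp. nodally) totally
ramified" [cite: Mochizuki2012, IUTchI Rmk 1.2.3(iv)-(v) pp.41-43]; abc-iut FACT-LIST rows F-1930/F-1931
(`PSCDatum.CuspidalEdgeLikeCharacterization(Holds)`) and F-1937 (`NodalEdgeLikeCharacterization(Holds)`),
typed by abc-iut-L3-t4.  PROOF-ONLY file (abc-iut-w5-d160, D-0079 L-F row F-1937; no definitions).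

The GENUINE TWO-TRIPOD DATUM of abc-iut-L5-t6 (`PSCTwoTripodOrigin.lean`, `PSCTwoTripodSigma.lean`): the
pointed stable curve of type `(0,4)` with two tripod components glued at one node, `Π` a pro-`Σ` completion
`ι : Γ_{0,4} → Π`, `Π_{v₁} = cl ι⟨c₁, c₁c₂⟩`, `Π_{v₂} = cl ι⟨c₁c₂, c₃⟩`, `Π_e = cl ι⟨c₁c₂⟩`, cusp groups
`cl ι⟨c_j⟩` — at whose origin L5-t6 proved [CombGC] Prop. 1.2 (i)(ii), 1.5 (i)(ii), Thm. 1.6 (iii) (rows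
F-0459, F-0438, F-0440, F-0443, F-0461).  Here, by the reduction of `PSCEdgeLikeCharacterizationReduction.lean`
("(E) edge groups procyclic and infinite + (I) containment determines the edge", (I) from L5-t6's Prop. 1.2
(i) edge clause `twoTripod_openInterDeterminesComponent`, (E) from `infinite_freeFactor` /
`infinite_cuspInertia_closure`):

* `isNodal_iff_cond_maximal_of_twoTripod` — the UNGUARDED nodal characterization of Rmk. 1.2.3 (v) at
  every two-tripod-shaped datum with `Σ = {l}` (the typed row F-1937 itself is vacuous there: the datum has
  cusps, and F-1937 carries the printed `IsNoncuspidal` guard; its non-vacuous genuine instance is the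
  closed two-component datum of `PSCNodalCharacterizationTwoComponent.lean`);
* `cuspidalEdgeLikeCharacterization_of_twoTripod` — row F-1930 at every two-tripod-shaped datum (cusps
  labelled INJECTIVELY by `Fin 4`, as in L5-t6's shape; abc-iut-f-164's `…_of_cuspidallyStandard` wants a
  bijection), WITHOUT the malnormality route;
* `cuspidalEdgeLikeCharacterizationHolds_of_twoTripodShape` — **row F-1931 HOLDS at every origin of
  two-tripod-shaped data** (L5-t6's shape hypothesis VERBATIM, so it joins `twoTripodRows_of_shape`:
  F-0438 ∧ F-0459 ∧ F-0440 ∧ F-0443 ∧ F-0461 ∧ F-1931 there), and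
  `numericallyCuspidalIffHolds_of_twoTripodShape` — **row F-0458 ([CombGC] Thm. 1.6 (i) as printed)** at
  such origins with `Σ = {l}` (abc-iut-f-164's `numericallyCuspidalIffHolds_of_characterization`).

Instance forms at data of the shape of a genuine pointed stable curve (consistency evidence for the typed
rows, not the printed theorems for all pointed stable curves).  No side is taken on [IUTchIII] Cor. 3.12.
[cite: MochizukiCombGC2007, Prop 1.2(i) p.8] [cite: MochizukiCombGC2007, Thm 1.6(i) p.13]
-/

noncomputable section

namespace Literature.AnabelianGeometry.SemiGraphs

namespace PSCDatum

open scoped Pointwise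
open Literature.GroupTheory.CombinatorialGroupTheory
open Literature.AnabelianGeometry.AbsoluteAnabelian (IsTopologicallyFinitelyGenerated)
open SemiGraphOfAnabelioids (IsProSigmaCompletion infinite_cuspInertia_closure)
open SemiGraphOfAnabelioids.IsProSigmaCompletion (infinite_freeFactor)

universe u

section TwoTripod

variable {P : Type u} [Group P] [TopologicalSpace P] [IsTopologicalGroup P] [CompactSpace P]
  [T2Space P] [TotallyDisconnectedSpace P] {Sigma : Set ℕ}

omit [T2Space P] in
/-- **The unguarded nodal characterization of [IUTchI] Rmk. 1.2.3 (v) at every two-tripod-shaped datum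
with `Σ = {l}`**: `Π` profinite, a pro-`Σ` completion `ι : Γ_{0,4} → Π`, all nodes equal with node group
`cl ι⟨b 1⟩` for a free basis `b` of `Γ_{0,4}` (whatever the vertices and cusps).  A subgroup is nodal iff
it satisfies the typed ramification condition and is maximal for it.
[cite: Mochizuki2012, IUTchI Rmk 1.2.3(v) p.43] -/
theorem isNodal_iff_cond_maximal_of_twoTripod (hne : Sigma.Nonempty) (hprime : ∀ p ∈ Sigma, p.Prime)
    (ι : PuncturedSurfaceGroup 0 4 →* P) (hι : IsProSigmaCompletion Sigma ι)
    (b : FreeGroupBasis (Fin 3) (PuncturedSurfaceGroup 0 4)) (G : PSCDatum P)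
    (hN : ∀ e, G.nodeGp e = ((Subgroup.closure (b '' {1})).map ι).topologicalClosure)
    (hNs : ∀ e e' : G.graph.N, e = e') {l : ℕ} (hSl : G.Sigma = {l}) (A : Subgroup P) :
    G.IsNodal A ↔
      ((IsClosed (A : Set P) ∧ (∃ a : P, (Subgroup.zpowers a).topologicalClosure = A) ∧
          (A : Set P).Infinite ∧
          ∀ U : Subgroup P, U.Characteristic → IsOpen (U : Set P) →
            G.IsNodallyTotallyRamified (A ⊔ U) U) ∧
        ∀ B : Subgroup P,
          (IsClosed (B : Set P) ∧ (∃ b : P, (Subgroup.zpowers b).topologicalClosure = B) ∧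
              (B : Set P).Infinite ∧
              ∀ U : Subgroup P, U.Characteristic → IsOpen (U : Set P) →
                G.IsNodallyTotallyRamified (B ⊔ U) U) →
            A ≤ B → A = B) := by
  have hp : ∃ p ∈ Sigma, p.Prime := by
    obtain ⟨p, hp⟩ := hne
    exact ⟨p, hp, hprime p hp⟩
  haveI : Fact l.Prime := ⟨G.sigma_prime l (by rw [hSl]; exact Set.mem_singleton l)⟩
  have hpro : IsProSigma {l} P := hSl ▸ G.proSigma
  refine G.isNodal_iff_cond_maximal_of_containment
    (fun U => isPGroup_quotient_of_isProSigma_singleton hpro U)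
    (IsProSigmaCompletion.isTopologicallyFinitelyGenerated_of_puncturedSurfaceGroup (MulEquiv.refl _) hι)
    (fun e => ?_) (fun e => ?_) (fun e e' _ _ _ => hNs e e') A
  · rw [hN e, freeFactor_singleton_eq ι b 1, MonoidHom.map_zpowers]
    exact ⟨_, rfl⟩
  · rw [hN e]
    exact Set.infinite_coe_iff.mp (infinite_freeFactor b _ ⟨1, rfl⟩ hι hp)

/-- **[IUTchI] Rmk. 1.2.3 (iv), cuspidal part, as typed (row F-1930) at every two-tripod-shaped datum**
(L5-t6's shape: two distinct vertices `Π_{v₁} = cl ι⟨b 0, b 1⟩`, `Π_{v₂} = cl ι⟨b 1, b 2⟩` for the basis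
`(c₁, c₁c₂, c₃)`, one node `cl ι⟨b 1⟩`, cusps labelled injectively by `Fin 4` with the closed cusp inertia
groups, first component of genus `< 2`), by the Prop. 1.2 (i) route: (I) is L5-t6's
`twoTripod_openInterDeterminesComponent`, (E) is `infinite_cuspInertia_closure`.
[cite: Mochizuki2012, IUTchI Rmk 1.2.3(iv) pp.41-42] -/
theorem cuspidalEdgeLikeCharacterization_of_twoTripod (hne : Sigma.Nonempty)
    (hprime : ∀ p ∈ Sigma, p.Prime) (ι : PuncturedSurfaceGroup 0 4 →* P)
    (hι : IsProSigmaCompletion Sigma ι) (b : FreeGroupBasis (Fin 3) (PuncturedSurfaceGroup 0 4))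
    (hb : b 0 = PuncturedSurfaceGroup.c 1 ∧
      b 1 = PuncturedSurfaceGroup.c 1 * PuncturedSurfaceGroup.c 2 ∧ b 2 = PuncturedSurfaceGroup.c 3)
    (G : PSCDatum P) (v₁ v₂ : G.graph.V) (hv : v₁ ≠ v₂) (hV : ∀ v, v = v₁ ∨ v = v₂)
    (hV₁ : G.vertGp v₁ = ((Subgroup.closure (b '' {0, 1})).map ι).topologicalClosure)
    (hV₂ : G.vertGp v₂ = ((Subgroup.closure (b '' {1, 2})).map ι).topologicalClosure)
    (hN : ∀ e, G.nodeGp e = ((Subgroup.closure (b '' {1})).map ι).topologicalClosure)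
    (hNs : ∀ e e' : G.graph.N, e = e') (f : G.graph.C → Fin 4) (hf : Function.Injective f)
    (hC : ∀ c, G.cuspGp c =
      ((PuncturedSurfaceGroup.cuspInertia (g := 0) (f c)).map ι).topologicalClosure)
    (hg : G.genus v₁ < 2) : G.CuspidalEdgeLikeCharacterization := by
  have h04 : PuncturedSurfaceGroup.IsHyperbolicType 0 4 := by
    unfold PuncturedSurfaceGroup.IsHyperbolicType; norm_num
  have h12 := (G.twoTripod_openInterDeterminesComponent hne hprime ι hι b hb v₁ v₂ hv hV hV₁ hV₂ hN
    hNs f hf hC hg).2.1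
  refine G.cuspidalEdgeLikeCharacterization_of_edgeLikeOpenInter
    (IsProSigmaCompletion.isTopologicallyFinitelyGenerated_of_puncturedSurfaceGroup (MulEquiv.refl _) hι)
    (fun c => ?_) (fun c => ?_) h12
  · rw [hC c, PuncturedSurfaceGroup.cuspInertia, MonoidHom.map_zpowers]
    exact ⟨_, rfl⟩
  · rw [hC c]
    exact Set.infinite_coe_iff.mp (infinite_cuspInertia_closure hne hprime h04 ι hι (f c))

end TwoTripod

/-! ### Origin level: rows F-1931 and F-0458 at every origin of two-tripod-shaped data -/

section Origin

variable (Ω : PSCOrigin.{u})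

/-- **Row F-1931 ([IUTchI] Rmk. 1.2.3 (iv), cuspidal part) HOLDS at every origin of two-tripod-shaped
data** — abc-iut-L5-t6's shape hypothesis of `twoTripodRows_of_shape` VERBATIM (any nonempty `Σ`; the
typed characterization quantifies over the `l` with `Σ = {l}` itself).
[cite: Mochizuki2012, IUTchI Rmk 1.2.3(iv) pp.41-42] -/
theorem cuspidalEdgeLikeCharacterizationHolds_of_twoTripodShape
    (hΩ : ∀ ⦃Q : Type u⦄ [Group Q] [TopologicalSpace Q] (G : PSCDatum Q),
      Ω.IsOfPSCType G → ∃ (_ : IsTopologicalGroup Q), CompactSpace Q ∧ T2Space Q ∧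
        TotallyDisconnectedSpace Q ∧
        ∃ (S : Set ℕ) (ι : PuncturedSurfaceGroup 0 4 →* Q)
          (b : FreeGroupBasis (Fin 3) (PuncturedSurfaceGroup 0 4)) (v₁ v₂ : G.graph.V)
          (f : G.graph.C → Fin 4),
          S.Nonempty ∧ (∀ p ∈ S, p.Prime) ∧ IsProSigmaCompletion S ι ∧
          (b 0 = PuncturedSurfaceGroup.c 1 ∧ b 1 = PuncturedSurfaceGroup.c 1 * PuncturedSurfaceGroup.c 2 ∧
            b 2 = PuncturedSurfaceGroup.c 3) ∧
          v₁ ≠ v₂ ∧ (∀ v, v = v₁ ∨ v = v₂) ∧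
          G.vertGp v₁ = ((Subgroup.closure (b '' {0, 1})).map ι).topologicalClosure ∧
          G.vertGp v₂ = ((Subgroup.closure (b '' {1, 2})).map ι).topologicalClosure ∧
          (∀ e, G.nodeGp e = ((Subgroup.closure (b '' {1})).map ι).topologicalClosure) ∧
          (∀ e e' : G.graph.N, e = e') ∧ Function.Injective f ∧
          (∀ c, G.cuspGp c =
            ((PuncturedSurfaceGroup.cuspInertia (g := 0) (f c)).map ι).topologicalClosure) ∧
          G.genus v₁ < 2 ∧ (∀ e, G.graph.nodeEnds e = s(v₁, v₂))) :
    CuspidalEdgeLikeCharacterizationHolds Ω := by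
  intro Q _ _ _ G hG
  obtain ⟨_, hc, ht2, hd, S, ι, b, v₁, v₂, f, hne, hprime, hι, hb, hv, hV, hV₁, hV₂, hN, hNs, hf, hC,
    hg, -⟩ := hΩ G hG
  haveI := hc
  haveI := ht2
  haveI := hd
  exact G.cuspidalEdgeLikeCharacterization_of_twoTripod hne hprime ι hι b hb v₁ v₂ hv hV hV₁ hV₂ hN hNs
    f hf hC hg

/-- **Row F-0458 ([CombGC] Thm. 1.6 (i) as printed) HOLDS at every origin of two-tripod-shaped data with
`Σ = {l}`**: Prop. 1.2 (i) there is abc-iut-L5-t6's `prop12Holds_of_twoTripod`, F-1931 there is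
`cuspidalEdgeLikeCharacterizationHolds_of_twoTripodShape`, and F-0458 ⇐ F-0459 + F-1931 at profinite
pro-`l` origins is abc-iut-f-164's `numericallyCuspidalIffHolds_of_characterization`.
[cite: MochizukiCombGC2007, Thm 1.6(i) p.13] -/
theorem numericallyCuspidalIffHolds_of_twoTripodShape (l : ℕ)
    (hΩ : ∀ ⦃Q : Type u⦄ [Group Q] [TopologicalSpace Q] (G : PSCDatum Q),
      Ω.IsOfPSCType G → ∃ (_ : IsTopologicalGroup Q), CompactSpace Q ∧ T2Space Q ∧
        TotallyDisconnectedSpace Q ∧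
        ∃ (S : Set ℕ) (ι : PuncturedSurfaceGroup 0 4 →* Q)
          (b : FreeGroupBasis (Fin 3) (PuncturedSurfaceGroup 0 4)) (v₁ v₂ : G.graph.V)
          (f : G.graph.C → Fin 4),
          S.Nonempty ∧ (∀ p ∈ S, p.Prime) ∧ IsProSigmaCompletion S ι ∧
          (b 0 = PuncturedSurfaceGroup.c 1 ∧ b 1 = PuncturedSurfaceGroup.c 1 * PuncturedSurfaceGroup.c 2 ∧
            b 2 = PuncturedSurfaceGroup.c 3) ∧
          v₁ ≠ v₂ ∧ (∀ v, v = v₁ ∨ v = v₂) ∧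
          G.vertGp v₁ = ((Subgroup.closure (b '' {0, 1})).map ι).topologicalClosure ∧
          G.vertGp v₂ = ((Subgroup.closure (b '' {1, 2})).map ι).topologicalClosure ∧
          (∀ e, G.nodeGp e = ((Subgroup.closure (b '' {1})).map ι).topologicalClosure) ∧
          (∀ e e' : G.graph.N, e = e') ∧ Function.Injective f ∧
          (∀ c, G.cuspGp c =
            ((PuncturedSurfaceGroup.cuspInertia (g := 0) (f c)).map ι).topologicalClosure) ∧
          G.genus v₁ < 2 ∧ (∀ e, G.graph.nodeEnds e = s(v₁, v₂)))
    (hSig : ∀ ⦃Q : Type u⦄ [Group Q] [TopologicalSpace Q] [IsTopologicalGroup Q] (G : PSCDatum Q),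
      Ω.IsOfPSCType G → G.Sigma = {l}) :
    NumericallyCuspidalIffHolds Ω := by
  have h12 : OpenInterDeterminesComponentHolds Ω := (prop12Holds_of_twoTripod Ω fun Q _ _ _ G hG => by
    obtain ⟨_, h1, h2, h3, S, ι, b, v₁, v₂, f, h⟩ := hΩ G hG
    exact ⟨h1, h2, h3, S, ι, b, v₁, v₂, f, h.1, h.2.1, h.2.2.1, h.2.2.2.1, h.2.2.2.2.1, h.2.2.2.2.2.1,
      h.2.2.2.2.2.2.1, h.2.2.2.2.2.2.2.1, h.2.2.2.2.2.2.2.2.1, h.2.2.2.2.2.2.2.2.2.1,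
      h.2.2.2.2.2.2.2.2.2.2.1, h.2.2.2.2.2.2.2.2.2.2.2.1, h.2.2.2.2.2.2.2.2.2.2.2.2.1⟩).2
  exact numericallyCuspidalIffHolds_of_characterization Ω l
    (fun Q _ _ _ G hG => by
      obtain ⟨_, h1, -, h3, -⟩ := hΩ G hG
      exact ⟨h1, h3⟩)
    hSig h12 (cuspidalEdgeLikeCharacterizationHolds_of_twoTripodShape Ω hΩ)

end Origin

end PSCDatum

end Literature.AnabelianGeometry.SemiGraphs

end
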